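import Summits.Langlands.Langlands.Theorems.IrreducibilityBySelfDualityIrreducibleOffSectorTensorProduct
import HarnessLib

/-!
# `IrreducibleOffSector`: the TENSOR-PRODUCT (Rankin–Selberg) ASCENT operator
(crux stmt-Langlands-14329 `IrreducibilityBySelfDuality.IrreducibleOffSector`, line `Sketch`;
`--supports` file, STRUCTURAL: no import of the route module; continuation lead c5)

Fourth closure operator on the crux's conclusion (after the twist closure p120193, the base-change
descent p121124 and the automorphic-induction ascent p122816).  Let `σ` on `GL_m(𝔸_K)` and `τ` on
`GL_n(𝔸_K)` be automorphic data and `Π` on `GL_{mn}(𝔸_K)` a WEAK FUNCTORIAL TENSOR PRODUCT of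
`σ` and `τ`: at almost all places the Satake parameter of `Π` is the multiset of pairwise products
`t_{Π,v} = t_{σ,v} ⊙ t_{τ,v} = {ab : a ∈ t_{σ,v}, b ∈ t_{τ,v}}` (the unramified local
Rankin–Selberg transfer `GL_m × GL_n → GL_{mn}`; a theorem for `GL_2 × GL_2 → GL_4`, Ramakrishnan
2000, and `GL_2 × GL_3 → GL_6`, Kim–Shahidi 2002).  If `σ`, `τ` have `ℓ`-adic avatars `ρ_σ`, `ρ_τ`
(Satake–Frobenius compatible a.e.) whose tensor product `ρ_σ ⊗ ρ_τ` is IRREDUCIBLE, then EVERY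
`ρ : Γ_K → GL_{mn}(ℚ̄_ℓ)` Satake–Frobenius compatible with `(Π, ι)` at almost all places is
irreducible:

* `eventually_satakeFrobCompatibleAt_tensor` — `ρ_σ ⊗ ρ_τ` is an a.e.-compatible avatar of `Π`
  (`hasFrobCharpolyAt_tensor_arithFrobPolyOfSatake`, `isUnramifiedAt_tensor` of `…TensorProduct`,
  p124360, and a.e.-unramifiedness of `Π`, `hasSatakeParamAt_cofinite_holds`);
* `isIrreducible_of_isTensorLift` — **the operator**, by the Chebotarev–Brauer–Nesbitt transfer
  `isIrreducible_of_satakeFrobCompatible` (p79199);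
* `isIrreducible_of_isTensorLift'` — the same with the avatar supplied by `exists_tensor`, the
  irreducibility hypothesis quantified over all framed tensor products of `ρ_σ`, `ρ_τ`;
* `irreducibleOffSector_conclusion_of_tensorLift` — binder shape of the crux.

What it opens (for the planner's map of the open content): the region of cuspidal `Π` on `GL_4`
(resp. `GL_6`) over totally real or CM `K` that are Ramakrishnan (resp. Kim–Shahidi) products of
regular algebraic cuspidal `σ`, `τ` of Galois type / CM type / with lang.S27 avatars — there the
crux reduces to the irreducibility of ONE tensor product `ρ_σ ⊗ ρ_τ` at the given `λ` (classical
for pairs of non-CM, non-twist-equivalent Hilbert newforms).  Nothing is assumed about cuspidality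
of `Π`: the operator is a statement about compatible systems.

References: D. Ramakrishnan, *Modularity of the Rankin–Selberg L-series, and multiplicity one for
SL(2)*, Ann. of Math. 152 (2000), Thm. M and §3; H. Kim, F. Shahidi, *Functorial products for
GL₂ × GL₃ and the symmetric cube for GL₂*, Ann. of Math. 155 (2002), Thm. A; J.-P. Serre, *Linear
representations of finite groups* (1977), §1.5; K. Buzzard, T. Gee, LMS LNS 414 (2014), §2.1.
-/

noncomputable section

set_option linter.dupNamespace false

open scoped NumberField Classical Polynomial Matrix Kronecker
open Filter IsDedekindDomain Polynomial
open Literature.NumberTheory.Automorphic Literature.NumberTheory.GaloisRepresentations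
open Summit.Langlands

namespace Summit.Langlands.Langlands.Theorems.IrreducibleOffSector

section Ascent

variable {K : Type} [Field K] [NumberField K] {ℓ : ℕ} [Fact ℓ.Prime] {m n : ℕ}
  {hm : isCompact_glFiniteIntegralLevel m K} {hn : isCompact_glFiniteIntegralLevel n K}
  {hmn : isCompact_glFiniteIntegralLevel (m * n) K}

/-- **The tensor product of avatars is an avatar of the tensor lift.**  Let `Π` be a weak
functorial tensor product of `σ` and `τ` (`t_{Π,v} = t_{σ,v} ⊙ t_{τ,v}` at almost all `v`), and let
`ρ_σ`, `ρ_τ` be Satake–Frobenius compatible with `(σ, ι)`, `(τ, ι)` at almost all places.  Then any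
framed tensor product `ρ_T` of `ρ_σ`, `ρ_τ` (matrices `reindex (ρ_σ(g) ⊗ₖ ρ_τ(g))`) is
Satake–Frobenius compatible with `(Π, ι)` at almost all places: `Π` is unramified a.e.
(`hasSatakeParamAt_cofinite_holds`), `ρ_T` is unramified where `ρ_σ`, `ρ_τ` are, and its Frobenius
polynomial is `arithFrobPolyOfSatake ι q_v 1 (t_{σ,v} ⊙ t_{τ,v})`
(`hasFrobCharpolyAt_tensor_arithFrobPolyOfSatake`).
[cite: BuzzardGeeLMS2014, §2.1 and Conj. 3.2.1] [cite: SerreLinearRepresentations1977, §1.5] -/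
theorem eventually_satakeFrobCompatibleAt_tensor (ι : PadicAlgCl ℓ ≃+* ℂ)
    (σ : AutomorphicRepData (AutomorphyDatum.gl m K hm))
    (τ : AutomorphicRepData (AutomorphyDatum.gl n K hn))
    (P : AutomorphicRepData (AutomorphyDatum.gl (m * n) K hmn))
    (hT : ∀ᶠ v : HeightOneSpectrum (𝓞 K) in cofinite, ∀ α β γ : Multiset ℂ,
      σ.HasSatakeParamAt v α → τ.HasSatakeParamAt v β → P.HasSatakeParamAt v γ →
        γ = (α ×ˢ β).map fun p => p.1 * p.2)
    {ρσ : FramedGaloisRep K (PadicAlgCl ℓ) m} {ρτ : FramedGaloisRep K (PadicAlgCl ℓ) n}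
    (hσ : ∀ᶠ v : HeightOneSpectrum (𝓞 K) in cofinite, SatakeFrobCompatibleAt ι σ ρσ v)
    (hτ : ∀ᶠ v : HeightOneSpectrum (𝓞 K) in cofinite, SatakeFrobCompatibleAt ι τ ρτ v)
    {ρT : FramedGaloisRep K (PadicAlgCl ℓ) (m * n)}
    (hρT : ∀ g, ((ρT g : GL (Fin (m * n)) (PadicAlgCl ℓ)) :
        Matrix (Fin (m * n)) (Fin (m * n)) (PadicAlgCl ℓ)) =
      Matrix.reindex finProdFinEquiv finProdFinEquiv
        (((ρσ g : GL (Fin m) (PadicAlgCl ℓ)) : Matrix (Fin m) (Fin m) (PadicAlgCl ℓ)) ⊗ₖ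
          ((ρτ g : GL (Fin n) (PadicAlgCl ℓ)) : Matrix (Fin n) (Fin n) (PadicAlgCl ℓ)))) :
    ∀ᶠ v : HeightOneSpectrum (𝓞 K) in cofinite, SatakeFrobCompatibleAt ι P ρT v := by
  filter_upwards [hT, hσ, hτ, AutomorphicRepData.hasSatakeParamAt_cofinite_holds P] with v hTv hσv
    hτv hPv
  obtain ⟨α, hα, hurσ, hcpσ⟩ := hσv
  obtain ⟨β, hβ, hurτ, hcpτ⟩ := hτv
  obtain ⟨γ, hγ⟩ := hPv
  refine ⟨γ, hγ, isUnramifiedAt_tensor hρT hurσ hurτ, ?_⟩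
  rw [hTv α β γ hα hβ hγ]
  exact hasFrobCharpolyAt_tensor_arithFrobPolyOfSatake hρT ι v.residueCard hcpσ hcpτ

/-- **TENSOR-PRODUCT ASCENT of the crux's conclusion.**  Let `Π` on `GL_{mn}(𝔸_K)` be a weak
functorial tensor product of `σ` on `GL_m(𝔸_K)` and `τ` on `GL_n(𝔸_K)` (`t_{Π,v} = t_{σ,v} ⊙ t_{τ,v}`
a.e.; Ramakrishnan 2000 for `2 × 2`, Kim–Shahidi 2002 for `2 × 3`), let `ρ_σ`, `ρ_τ` be avatars of
`σ`, `τ` (a.e.-compatible with `ι`), and let `ρ_T` be a framed tensor product of `ρ_σ`, `ρ_τ` which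
is IRREDUCIBLE.  Then every `ρ : Γ_K → GL_{mn}(ℚ̄_ℓ)` Satake–Frobenius compatible with `(Π, ι)` at
almost all places is irreducible: `ρ_T` is an irreducible a.e.-compatible avatar of `Π`
(`eventually_satakeFrobCompatibleAt_tensor`), and the Chebotarev–Brauer–Nesbitt transfer
`isIrreducible_of_satakeFrobCompatible` (p79199) applies.  No cuspidality of `Π` is used.
[cite: BuzzardGeeLMS2014, Conj. 3.2.1] [cite: SerreLinearRepresentations1977, §1.5] -/
theorem isIrreducible_of_isTensorLift (ι : PadicAlgCl ℓ ≃+* ℂ)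
    (σ : AutomorphicRepData (AutomorphyDatum.gl m K hm))
    (τ : AutomorphicRepData (AutomorphyDatum.gl n K hn))
    (P : AutomorphicRepData (AutomorphyDatum.gl (m * n) K hmn))
    (hT : ∀ᶠ v : HeightOneSpectrum (𝓞 K) in cofinite, ∀ α β γ : Multiset ℂ,
      σ.HasSatakeParamAt v α → τ.HasSatakeParamAt v β → P.HasSatakeParamAt v γ →
        γ = (α ×ˢ β).map fun p => p.1 * p.2)
    {ρσ : FramedGaloisRep K (PadicAlgCl ℓ) m} {ρτ : FramedGaloisRep K (PadicAlgCl ℓ) n}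
    (hσ : ∀ᶠ v : HeightOneSpectrum (𝓞 K) in cofinite, SatakeFrobCompatibleAt ι σ ρσ v)
    (hτ : ∀ᶠ v : HeightOneSpectrum (𝓞 K) in cofinite, SatakeFrobCompatibleAt ι τ ρτ v)
    {ρT : FramedGaloisRep K (PadicAlgCl ℓ) (m * n)}
    (hρT : ∀ g, ((ρT g : GL (Fin (m * n)) (PadicAlgCl ℓ)) :
        Matrix (Fin (m * n)) (Fin (m * n)) (PadicAlgCl ℓ)) =
      Matrix.reindex finProdFinEquiv finProdFinEquiv
        (((ρσ g : GL (Fin m) (PadicAlgCl ℓ)) : Matrix (Fin m) (Fin m) (PadicAlgCl ℓ)) ⊗ₖ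
          ((ρτ g : GL (Fin n) (PadicAlgCl ℓ)) : Matrix (Fin n) (Fin n) (PadicAlgCl ℓ))))
    (hirr : ρT.toGaloisRep.IsIrreducible)
    (ρ : FramedGaloisRep K (PadicAlgCl ℓ) (m * n))
    (hρ : ∀ᶠ v : HeightOneSpectrum (𝓞 K) in cofinite, SatakeFrobCompatibleAt ι P ρ v) :
    ρ.toGaloisRep.IsIrreducible :=
  isIrreducible_of_satakeFrobCompatible P ι hirr
    (eventually_satakeFrobCompatibleAt_tensor ι σ τ P hT hσ hτ hρT) hρ

/-- **Tensor-product ascent, avatar-free form.**  As `isIrreducible_of_isTensorLift`, with the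
framed tensor product supplied by `exists_tensor` and the irreducibility hypothesis stated for every
framed tensor product of `ρ_σ`, `ρ_τ` (they are all equal; the quantifier avoids naming one).
[cite: BuzzardGeeLMS2014, Conj. 3.2.1] -/
theorem isIrreducible_of_isTensorLift' (ι : PadicAlgCl ℓ ≃+* ℂ)
    (σ : AutomorphicRepData (AutomorphyDatum.gl m K hm))
    (τ : AutomorphicRepData (AutomorphyDatum.gl n K hn))
    (P : AutomorphicRepData (AutomorphyDatum.gl (m * n) K hmn))
    (hT : ∀ᶠ v : HeightOneSpectrum (𝓞 K) in cofinite, ∀ α β γ : Multiset ℂ,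
      σ.HasSatakeParamAt v α → τ.HasSatakeParamAt v β → P.HasSatakeParamAt v γ →
        γ = (α ×ˢ β).map fun p => p.1 * p.2)
    (ρσ : FramedGaloisRep K (PadicAlgCl ℓ) m) (ρτ : FramedGaloisRep K (PadicAlgCl ℓ) n)
    (hσ : ∀ᶠ v : HeightOneSpectrum (𝓞 K) in cofinite, SatakeFrobCompatibleAt ι σ ρσ v)
    (hτ : ∀ᶠ v : HeightOneSpectrum (𝓞 K) in cofinite, SatakeFrobCompatibleAt ι τ ρτ v)
    (hirr : ∀ ρT : FramedGaloisRep K (PadicAlgCl ℓ) (m * n),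
      (∀ g, ((ρT g : GL (Fin (m * n)) (PadicAlgCl ℓ)) :
          Matrix (Fin (m * n)) (Fin (m * n)) (PadicAlgCl ℓ)) =
        Matrix.reindex finProdFinEquiv finProdFinEquiv
          (((ρσ g : GL (Fin m) (PadicAlgCl ℓ)) : Matrix (Fin m) (Fin m) (PadicAlgCl ℓ)) ⊗ₖ
            ((ρτ g : GL (Fin n) (PadicAlgCl ℓ)) : Matrix (Fin n) (Fin n) (PadicAlgCl ℓ)))) →
      ρT.toGaloisRep.IsIrreducible)
    (ρ : FramedGaloisRep K (PadicAlgCl ℓ) (m * n))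
    (hρ : ∀ᶠ v : HeightOneSpectrum (𝓞 K) in cofinite, SatakeFrobCompatibleAt ι P ρ v) :
    ρ.toGaloisRep.IsIrreducible := by
  obtain ⟨ρT, hρT⟩ := exists_tensor ρσ ρτ
  exact isIrreducible_of_isTensorLift ι σ τ P hT hσ hτ hρT (hirr ρT hρT) ρ hρ

end Ascent

/-! ## In the binder shape of the crux -/

/-- **The tensor-lift region of `IrreducibleOffSector`** (binder shape of the crux at rank
`n = a·b`; every `a, b`, `K`; the cuspidality / L-algebraicity / off-sector hypotheses are carried,
not used): if `π` on `GL_{ab}(𝔸_K)` is a weak functorial tensor product `GL_a × GL_b → GL_{ab}` of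
automorphic data `σ`, `τ` such that for every `ℓ`, `ι` there are avatars `ρ_σ`, `ρ_τ` of `σ`, `τ`
all of whose framed tensor products are irreducible, then every `ρ` Satake–Frobenius compatible with
`(π, ι)` a.e. is irreducible. [cite: BuzzardGeeLMS2014, Conj. 3.2.1] -/
theorem irreducibleOffSector_conclusion_of_tensorLift :
    ∀ (a b : ℕ) (K : Type) [Field K] [NumberField K] (hcpt : isCompact_glFiniteIntegralLevel (a * b) K),
      0 < a * b → ∀ (π : CuspidalAutomorphicRepData (a * b) K hcpt),
        (∃ (ha : isCompact_glFiniteIntegralLevel a K) (hb : isCompact_glFiniteIntegralLevel b K)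
            (σ : AutomorphicRepData (AutomorphyDatum.gl a K ha))
            (τ : AutomorphicRepData (AutomorphyDatum.gl b K hb)),
          (∀ᶠ v : HeightOneSpectrum (𝓞 K) in cofinite, ∀ α β γ : Multiset ℂ,
            σ.HasSatakeParamAt v α → τ.HasSatakeParamAt v β → π.1.HasSatakeParamAt v γ →
              γ = (α ×ˢ β).map fun p => p.1 * p.2) ∧
          ∀ (ℓ : ℕ) [Fact ℓ.Prime] (ι : PadicAlgCl ℓ ≃+* ℂ),
            ∃ (ρσ : FramedGaloisRep K (PadicAlgCl ℓ) a) (ρτ : FramedGaloisRep K (PadicAlgCl ℓ) b),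
              (∀ᶠ v : HeightOneSpectrum (𝓞 K) in cofinite, SatakeFrobCompatibleAt ι σ ρσ v) ∧
              (∀ᶠ v : HeightOneSpectrum (𝓞 K) in cofinite, SatakeFrobCompatibleAt ι τ ρτ v) ∧
              ∀ ρT : FramedGaloisRep K (PadicAlgCl ℓ) (a * b),
                (∀ g, ((ρT g : GL (Fin (a * b)) (PadicAlgCl ℓ)) :
                    Matrix (Fin (a * b)) (Fin (a * b)) (PadicAlgCl ℓ)) =
                  Matrix.reindex finProdFinEquiv finProdFinEquiv
                    (((ρσ g : GL (Fin a) (PadicAlgCl ℓ)) : Matrix (Fin a) (Fin a) (PadicAlgCl ℓ)) ⊗ₖ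
                      ((ρτ g : GL (Fin b) (PadicAlgCl ℓ)) : Matrix (Fin b) (Fin b) (PadicAlgCl ℓ)))) →
                ρT.toGaloisRep.IsIrreducible) →
        π.1.IsLAlgebraic →
        ¬ (a * b = 3 ∧ NumberField.IsCMField K ∧
            ∃ T : InfinityType K (a * b), π.1.HasInfinityType T ∧ T.IsRegular) →
        ∀ (ℓ : ℕ) [Fact ℓ.Prime] (ι : PadicAlgCl ℓ ≃+* ℂ) (ρ : FramedGaloisRep K (PadicAlgCl ℓ) (a * b)),
          (∀ᶠ v : HeightOneSpectrum (𝓞 K) in cofinite, SatakeFrobCompatibleAt ι π.1 ρ v) →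
            ρ.toGaloisRep.IsIrreducible := by
  intro a b K _ _ hcpt _hn π hTL _hL _hsec ℓ _ ι ρ hρ
  obtain ⟨ha, hb, σ, τ, hT, hav⟩ := hTL
  obtain ⟨ρσ, ρτ, hσ, hτ, hirr⟩ := hav ℓ ι
  exact isIrreducible_of_isTensorLift' ι σ τ π.1 hT ρσ ρτ hσ hτ hirr ρ hρ

end Summit.Langlands.Langlands.Theorems.IrreducibleOffSector

end
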